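import Literature.AlgebraicGeometry.HodgeTheory.ComplexTorusIntegralHodgeClassesKunnethProjectors
import Literature.AlgebraicGeometry.HodgeTheory.ComplexTorusIntegralHodgeClassesCoincidenceNumbers
import HarnessLib

/-!
# The Künneth projectors are the eigenclasses of `(1_X × n_X)^*`: Lange's (6.15), (6.17), (6.18) on `Hdgᵍ(X × X, ℤ)`

Sequel of g29-#5 `ComplexTorusIntegralHodgeClassesKunnethProjectors` (`π_s = K_s[Δ_X] ∈ Hdgᵍ(X × X, ℤ)`, `Σ π_s = [Δ]`, `π_t ∘ π_s = δ_{st} π_s`,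
`ᵗπ_s = π_{2g−s}`). Birkenhake–Lange DEFINE the Künneth decomposition of `Ch^p(X × X)_ℚ` through the eigenspaces of the endomorphisms `(1_X × n_X)^*`:
"`Ch^p(X × X)^s_ℚ := {α ∈ Ch^p(X × X)_ℚ | (1_X × n_X)^*α = n^{2p−s} α for all n ∈ ℤ}`" ((6.15), p0316 L44–L45), "`π_i` denotes the component of `Δ` in
`Ch^g(X × X)^{2g−i}_ℚ`" (p0317 L30), and compute with "`ᵗΓ_{n_X} ∘ π_i = (1_X × n_X)^* π_i = nⁱ π_i` (6.17)", "`ᵗΓ_{n_X} = ᵗΓ_{n_X} ∘ Δ = Σ_{i=0}^{2g} ᵗΓ_{n_X} ∘ π_i =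
Σ_{i=0}^{2g} nⁱ π_i` (6.18)" (p0318 L8–L12). This file proves these identities for the integral Künneth projectors of a complex torus `X` of dimension `g`
(lattice rank `2g`), the endomorphism `1_X × n_X = prodMap (𝟙 X) (intMul X n)` of `X × X` acting by the pull-back `integralHodgeClassesPullbackHom` of g21, and
the characterisation of the `π_s` they afford (Voisin's uniqueness of the Künneth components, Thm. 11.38, on the integral carrier):

* §1 **`coe_integralHodgeClassesPullbackHom_prodMap_id_intMul`** — on forms `(1_Y × n_X)^*` is Layer A's `(1 × n)^* = (− ∘ scaleSnd n)` (A4-43), for every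
  `β ∈ Hdgᵖ(Y × X, ℤ)`;
* §2 **`integralHodgeClassesPullbackHom_prodMap_id_intMul_kunnethProjector`** — (6.17) `(1_X × n_X)^* π_s = nˢ π_s`, and
  **`integralHodgeClassesPullbackHom_prodMap_intMul_id_kunnethProjector`** — `(n_X × 1_X)^* π_s = n^{2g−s} π_s` (by `ᵗπ_s = π_{2g−s}`);
* §3 **`integralHodgeClassesPullbackHom_prodMap_id_intMul_diagonalClass`** — `(1_X × n_X)^*[Δ_X] = Σ_s nˢ π_s`,
  **`integralHodgeClassesPushforward_swapHom_graphClass_intMul`** — `ᵗΓ_{n_X} = τ_*[Γ_{n_X}] = (1_X × n_X)^*[Δ_X]` (both are `(p₁ − n p₂)^*[pt_X]`, g27-#4's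
  `[Γ_f] = (p₂ − f p₁)^*[pt]`), hence **`integralHodgeClassesPushforward_swapHom_graphClass_intMul_eq_sum`** — (6.18) `ᵗΓ_{n_X} = Σ_{s=0}^{2g} nˢ π_s` — and
  **`graphClass_intMul_eq_sum`** — `[Γ_{n_X}] = Σ_{s=0}^{2g} nˢ π_{2g−s}`;
* §4 **`kunnethProjector_unique`** — the `π_s` are THE decomposition of `[Δ_X]` into eigenclasses: if `[Δ_X] = Σ_{s ≤ 2g} β_s` in `Hdgᵍ(X × X, ℤ)` with
  `(1_X × j_X)^* β_s = jˢ β_s` for the `2g + 1` nodes `j = 0, …, 2g`, then `β_s = π_s` (Lagrange interpolation over `ℚ`, Layer A's `kunnethCoeff`; Voisin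
  Thm. 11.38, Lange (6.16)).

## References
* [Lange2023AbelianVarietiesComplex] H. Lange, Abelian Varieties over the Complex Numbers, Springer 2023, §6.3.3 (6.15)–(6.16) (p0316 L33 – p0317 L10),
  §6.3.4 (6.17)–(6.18) (p0318 L8–L12), Prop. 6.3.10 (p0318 L48 – p0319 L7).
* [VoisinHodgeI2002] C. Voisin, Hodge Theory and Complex Algebraic Geometry I, CUP 2002, §11.3.3 Thm. 11.38 and p. 287.
* [Fulton1998] W. Fulton, Intersection Theory, 2nd ed., Springer 1998, §16.1 Def. 16.1.1, Prop. 16.1.1 (c)(ii), Example 16.1.4.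
-/

noncomputable section

open CategoryTheory Function

namespace Literature.AlgebraicGeometry.HodgeTheory

open Literature.AlgebraicGeometry.Motives Literature.AlgebraicGeometry.Motives.HodgeStructure
open Literature.Geometry.Kaehler Literature.Geometry.Kaehler.ComplexTorus

/-! ### §0 Lagrange interpolation at the integer nodes (forms) -/

section Forms

variable {V W : Type*} [NormedAddCommGroup V] [NormedSpace ℂ V] [NormedAddCommGroup W] [NormedSpace ℂ W]

/-- `K_s γ = δ_{s,s₀} γ` as soon as `γ ∘ (1 × j) = j^{s₀} γ` at the `k + 1` integer nodes `j = 0, …, k` (the interpolation in the definition of `K_s` only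
uses these nodes; A4-43 `IsKunnethType.kunnethComponent_eq` asks it for all real `t`). [cite: Lange2023AbelianVarietiesComplex, §6.3.3 (6.15)–(6.16)] -/
private theorem kunnethComponent_eq_ite_of_forall_nat₉ {k s₀ : ℕ} (hs₀ : s₀ ≤ k) {γ : (V × W) [⋀^Fin k]→L[ℝ] ℂ}
    (h : ∀ j : ℕ, j ≤ k → γ.compContinuousLinearMap (scaleSnd (j : ℝ)) = (((j : ℕ) : ℂ) ^ s₀) • γ) (s : ℕ) :
    kunnethComponent s γ = if s = s₀ then γ else 0 := by
  unfold kunnethComponent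
  have h' : ∀ j : Fin (k + 1), γ.compContinuousLinearMap (scaleSnd ((j : ℕ) : ℝ)) = (((j : ℕ) : ℂ) ^ s₀) • γ := fun j ↦ h j (Nat.le_of_lt_succ j.2)
  simp_rw [h', smul_smul, ← Finset.sum_smul]
  have hsum : ∑ j : Fin (k + 1), ((kunnethCoeff k s j : ℚ) : ℂ) * ((j : ℕ) : ℂ) ^ s₀ = ((if s = s₀ then (1 : ℚ) else 0 : ℚ) : ℂ) := by
    rw [← sum_kunnethCoeff_mul_pow k s hs₀]
    push_cast
    rfl
  rw [hsum]
  split_ifs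
  · rw [Rat.cast_one, one_smul]
  · rw [Rat.cast_zero, zero_smul]

end Forms

namespace ComplexTorusCat

/-! ### §1 `(1_Y × n_X)^*` on integral Hodge classes is Layer A's `(1 × n)^*` -/

section Scale

variable {Y X : ComplexTorusCat} {p : ℕ}

/-- **On forms, `(1_Y × n_X)^* β = β ∘ (1 × n)`** for `β ∈ Hdgᵖ(Y × X, ℤ)`: the pull-back along the endomorphism `1_Y × n_X` of `Y × X` (g21
`integralHodgeClassesPullbackHom`, `ρ_r(1 × n_X) = diag(1, n·1)`) is pre-composition with Layer A's `scaleSnd n = (1, n)` (A4-43; Lange's `(1_X × n_X)^*` of (6.15)).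
[cite: Lange2023AbelianVarietiesComplex, §6.3.3 (6.15) (p0316 L40–L45)] -/
theorem coe_integralHodgeClassesPullbackHom_prodMap_id_intMul (n : ℤ) (β : integralHodgeClasses (prodObj Y X).toIsog.Φ p) :
    ((integralHodgeClassesPullbackHom (prodMap (𝟙 Y) (intMul X n)) p β : integralHodgeClasses (prodObj Y X).toIsog.Φ p) : (Y.toIsog.E × X.toIsog.E) [⋀^Fin (2 * p)]→L[ℝ] ℂ) =
      ((β : integralHodgeClasses (prodObj Y X).toIsog.Φ p) : (Y.toIsog.E × X.toIsog.E) [⋀^Fin (2 * p)]→L[ℝ] ℂ).compContinuousLinearMap (scaleSnd (n : ℝ)) := by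
  rw [coe_integralHodgeClassesPullbackHom_apply, prodMap_val, id_val, intMul_val]
  erw [realRep_fromBlocks_one_smul_one]

/-- The same with a natural multiplier `j` (the interpolation nodes). [cite: Lange2023AbelianVarietiesComplex, §6.3.3 (6.15) (p0316 L40–L45)] -/
theorem coe_integralHodgeClassesPullbackHom_prodMap_id_intMul_natCast (j : ℕ) (β : integralHodgeClasses (prodObj Y X).toIsog.Φ p) :
    ((integralHodgeClassesPullbackHom (prodMap (𝟙 Y) (intMul X j)) p β : integralHodgeClasses (prodObj Y X).toIsog.Φ p) : (Y.toIsog.E × X.toIsog.E) [⋀^Fin (2 * p)]→L[ℝ] ℂ) =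
      ((β : integralHodgeClasses (prodObj Y X).toIsog.Φ p) : (Y.toIsog.E × X.toIsog.E) [⋀^Fin (2 * p)]→L[ℝ] ℂ).compContinuousLinearMap (scaleSnd (j : ℝ)) := by
  rw [coe_integralHodgeClassesPullbackHom_prodMap_id_intMul, Int.cast_natCast]

end Scale

section Diagonal

variable (X : ComplexTorusCat) {g₁ g : ℕ} (eX : Fin (2 * g₁) ≃ X.toIsog.ι) (e : Fin (2 * g) ≃ (prodObj X X).toIsog.ι)
  (hX : 2 * g₁ + 2 * 0 = 2 * g₁) (hg₁ : g₁ + g₁ = 2 * g₁) (hc : 2 * g₁ + 2 * g₁ = 2 * g) (hg' : g + g = 2 * g)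

/-! ### §2 (6.17): `(1_X × n_X)^* π_s = nˢ π_s` -/

/-- **(6.17) ON INTEGRAL HODGE CLASSES: `(1_X × n_X)^* π_s = nˢ · π_s`** — the Künneth projector `π_s = K_s[Δ_X] ∈ H^{2g−s}(X) ⊗ Hˢ(X)` is an eigenclass of
`(1_X × n_X)^*` with eigenvalue `nˢ` ("`ᵗΓ_{n_X} ∘ π_i = (1_X × n_X)^*π_i = nⁱ π_i`"; the eigenspace `Ch^g(X × X)^{2g−i}` of (6.15)). Proof: §1 and Layer A's
`kunnethComponent_compContinuousLinearMap_scaleSnd` (`K_s γ ∘ (1 × t) = tˢ K_s γ`). [cite: Lange2023AbelianVarietiesComplex, §6.3.4 (6.17) (p0318 L8–L9) and §6.3.3 (6.15)] -/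
theorem integralHodgeClassesPullbackHom_prodMap_id_intMul_kunnethProjector (n : ℤ) (s : ℕ) :
    integralHodgeClassesPullbackHom (prodMap (𝟙 X) (intMul X n)) g₁ (kunnethProjector X eX e hX hg₁ hc hg' s) = (n ^ s) • kunnethProjector X eX e hX hg₁ hc hg' s := by
  refine Subtype.ext ?_
  rw [coe_integralHodgeClassesPullbackHom_prodMap_id_intMul, AddSubgroupClass.coe_zsmul, ← Int.cast_smul_eq_zsmul ℂ, Int.cast_pow, coe_kunnethProjector,
    kunnethComponent_compContinuousLinearMap_scaleSnd, Complex.ofReal_intCast]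

/-- `(n_X × 1_X) = τ ≫ (1_X × n_X) ≫ τ` for the exchange of factors `τ`. [cite: Lange2023AbelianVarietiesComplex, §6.3.4 Prop. 6.3.10 (proof, p0318 L52)] -/
theorem swapHom_comp_prodMap_id_intMul_comp_swapHom (n : ℤ) :
    (swapHom X X ≫ prodMap (𝟙 X) (intMul X n)) ≫ swapHom X X = prodMap (intMul X n) (𝟙 X) := by
  refine prod_hom_ext ?_ ?_
  · simp only [Category.assoc, swapHom_fstHom, prodMap_sndHom, swapHom_sndHom_assoc, prodMap_fstHom]
  · simp only [Category.assoc, swapHom_sndHom, prodMap_fstHom, swapHom_fstHom_assoc, prodMap_sndHom]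

/-- **`(n_X × 1_X)^* π_s = n^{2g−s} · π_s`** (`s ≤ 2g`): the other factor scales the Künneth projector by the complementary power ("`(n_X × 1_X)^* ᵗπ_i =
ᵗ((1_X × n_X)^* π_i) = nⁱ · ᵗπ_i`" with `ᵗπ_i = π_{2g−i}`, Prop. 6.3.10). Proof: `n × 1 = τ ≫ (1 × n) ≫ τ`, `τ^* = τ_*` (g27-#6), g29-#5's `τ_*π_s = π_{2g−s}`, and (6.17).
[cite: Lange2023AbelianVarietiesComplex, §6.3.4 Prop. 6.3.10 (proof, p0318 L50–L53)] -/
theorem integralHodgeClassesPullbackHom_prodMap_intMul_id_kunnethProjector (n : ℤ) {s : ℕ} (hs : s ≤ 2 * g₁) :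
    integralHodgeClassesPullbackHom (prodMap (intMul X n) (𝟙 X)) g₁ (kunnethProjector X eX e hX hg₁ hc hg' s) = (n ^ (2 * g₁ - s)) • kunnethProjector X eX e hX hg₁ hc hg' s := by
  rw [← swapHom_comp_prodMap_id_intMul_comp_swapHom, integralHodgeClassesPullbackHom_comp, integralHodgeClassesPullbackHom_comp,
    ← integralHodgeClassesPushforward_swapHom X X e e hc hg' (kunnethProjector X eX e hX hg₁ hc hg' s),
    integralHodgeClassesPushforward_swapHom_kunnethProjector X eX e hX hg₁ hc hg' s (2 * g₁ - s) (by omega),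
    integralHodgeClassesPullbackHom_prodMap_id_intMul_kunnethProjector, map_zsmul,
    ← integralHodgeClassesPushforward_swapHom X X e e hc hg' (kunnethProjector X eX e hX hg₁ hc hg' (2 * g₁ - s)),
    integralHodgeClassesPushforward_swapHom_kunnethProjector X eX e hX hg₁ hc hg' (2 * g₁ - s) s (by omega)]

/-! ### §3 (6.18): `ᵗΓ_{n_X} = (1_X × n_X)^*[Δ_X] = Σ_s nˢ π_s` -/

/-- **`(1_X × n_X)^*[Δ_X] = Σ_{s=0}^{2g} nˢ · π_s`** (`[Δ] = Σ π_s`, (6.17) and additivity of the pull-back). [cite: Lange2023AbelianVarietiesComplex, §6.3.4 (6.18) (p0318 L10–L12)] -/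
theorem integralHodgeClassesPullbackHom_prodMap_id_intMul_diagonalClass (n : ℤ) :
    integralHodgeClassesPullbackHom (prodMap (𝟙 X) (intMul X n)) g₁ (integralHodgeClassesPushforward 0 g₁ (diagHom X) eX e hX hg₁ hc hg' (unitIntegralHodgeClass X)) =
      ∑ s ∈ Finset.range (2 * g₁ + 1), (n ^ s) • kunnethProjector X eX e hX hg₁ hc hg' s := by
  rw [← sum_range_kunnethProjector, map_sum]
  exact Finset.sum_congr rfl fun s _ ↦ integralHodgeClassesPullbackHom_prodMap_id_intMul_kunnethProjector X eX e hX hg₁ hc hg' n s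

/-- `τ ≫ (p₂ − n p₁) = p₁ − n p₂`. [cite: Fulton1998, §16.1 Example 16.1.4 (p0297 L17–L20)] -/
theorem swapHom_comp_sndHom_sub_fstHom_comp_intMul (n : ℤ) :
    swapHom X X ≫ (sndHom X X - fstHom X X ≫ intMul X n) = fstHom X X - sndHom X X ≫ intMul X n := by
  rw [Preadditive.comp_sub, swapHom_sndHom, ← Category.assoc, swapHom_fstHom]

/-- `(1 × n) ≫ (p₂ − p₁) = n p₂ − p₁`. [cite: Lange2023AbelianVarietiesComplex, §6.3.3 (p0316 L40–L42)] -/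
theorem prodMap_id_intMul_comp_sndHom_sub_fstHom (n : ℤ) :
    prodMap (𝟙 X) (intMul X n) ≫ (sndHom X X - fstHom X X) = sndHom X X ≫ intMul X n - fstHom X X := by
  rw [Preadditive.comp_sub, prodMap_sndHom, prodMap_fstHom, Category.comp_id]

/-- `(p₁ − n p₂) ≫ (−1)_X = n p₂ − p₁`. [cite: Lange2023AbelianVarietiesComplex, §1.1.2 (p0021 L5)] -/
theorem fstHom_sub_sndHom_comp_intMul_comp_intMul_neg_one (n : ℤ) :
    (fstHom X X - sndHom X X ≫ intMul X n) ≫ intMul X (-1) = sndHom X X ≫ intMul X n - fstHom X X := by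
  rw [comp_intMul, neg_smul, one_smul, neg_sub]

/-- **`ᵗΓ_{n_X} = (1_X × n_X)^*[Δ_X]`**: the transpose `τ_*[Γ_{n_X}]` of the graph class of `n_X` (g27-#6) is the pull-back of the diagonal class along `1_X × n_X`
— both are `(p₁ − n p₂)^*[pt_X]` (g27-#4 `[Γ_f] = (p₂ − f p₁)^*[pt_Y]`, `[Δ] = (p₂ − p₁)^*[pt]`, `τ_* = τ^*`, `(−1)^*[pt] = [pt]`); Lange: "`ᵗΓ_{n_X} = ᵗΓ_{n_X} ∘ Δ`" with
Prop. 6.2.10 (a) `ᵗΓ_f ∘ α = (1 × f)^*α`. [cite: Lange2023AbelianVarietiesComplex, §6.3.4 (6.18) (p0318 L10–L12) and §6.2.2 Prop. 6.2.10 (a) (p0304 L25–L27)]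
[cite: Fulton1998, §16.1 Prop. 16.1.1 (c)(ii) (p0293 L25)] -/
theorem integralHodgeClassesPushforward_swapHom_graphClass_intMul (n : ℤ) :
    integralHodgeClassesPushforward g₁ g₁ (swapHom X X) e e hc hg' hc hg'
        (integralHodgeClassesPushforward 0 g₁ (graphHom (intMul X n)) eX e hX hg₁ hc hg' (unitIntegralHodgeClass X)) =
      integralHodgeClassesPullbackHom (prodMap (𝟙 X) (intMul X n)) g₁ (integralHodgeClassesPushforward 0 g₁ (diagHom X) eX e hX hg₁ hc hg' (unitIntegralHodgeClass X)) := by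
  rw [integralHodgeClassesPushforward_swapHom, integralHodgeClassesPushforward_graphHom_unitIntegralHodgeClass (intMul X n) eX eX e hX hg₁ hc hg',
    integralHodgeClassesPushforward_diagHom_unitIntegralHodgeClass X eX hX hg₁ hg' eX e hc, ← integralHodgeClassesPullbackHom_comp, ← integralHodgeClassesPullbackHom_comp,
    swapHom_comp_sndHom_sub_fstHom_comp_intMul, prodMap_id_intMul_comp_sndHom_sub_fstHom, ← fstHom_sub_sndHom_comp_intMul_comp_intMul_neg_one,
    integralHodgeClassesPullbackHom_comp, integralHodgeClassesPullbackHom_intMul_pointIntegralHodgeClass, show ((-1 : ℤ) ^ (2 * g₁)) = 1 by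
      rw [pow_mul, neg_one_sq, one_pow], one_zsmul]

/-- **(6.18) ON INTEGRAL HODGE CLASSES: `ᵗΓ_{n_X} = Σ_{s=0}^{2g} nˢ · π_s`** — the transposed graph class of the multiplication `n_X` decomposes along the Künneth
projectors with the eigenvalues `nˢ` ("`ᵗΓ_{n_X} = ᵗΓ_{n_X} ∘ Δ = Σ_{i=0}^{2g} ᵗΓ_{n_X} ∘ π_i = Σ_{i=0}^{2g} nⁱ π_i`", the identity whose Vandermonde inversion over
`ℚ` expresses the `π_i` through the `ᵗΓ_{n_X}`, `n = 0, …, 2g`). [cite: Lange2023AbelianVarietiesComplex, §6.3.4 (6.18) (p0318 L10–L12)] -/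
theorem integralHodgeClassesPushforward_swapHom_graphClass_intMul_eq_sum (n : ℤ) :
    integralHodgeClassesPushforward g₁ g₁ (swapHom X X) e e hc hg' hc hg'
        (integralHodgeClassesPushforward 0 g₁ (graphHom (intMul X n)) eX e hX hg₁ hc hg' (unitIntegralHodgeClass X)) =
      ∑ s ∈ Finset.range (2 * g₁ + 1), (n ^ s) • kunnethProjector X eX e hX hg₁ hc hg' s := by
  rw [integralHodgeClassesPushforward_swapHom_graphClass_intMul, integralHodgeClassesPullbackHom_prodMap_id_intMul_diagonalClass]

/-- **`[Γ_{n_X}] = Σ_{s=0}^{2g} nˢ · π_{2g−s}`**: the graph class of `n_X` itself (`[Γ_n] = ᵗ(ᵗΓ_n)`, `ᵗπ_s = π_{2g−s}`; equivalently `(n_X × 1_X)^*[Δ_X]`, Lange's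
(6.17)–(6.18) transposed as in the proof of Prop. 6.3.10). [cite: Lange2023AbelianVarietiesComplex, §6.3.4 (6.18) (p0318 L10–L12) and Prop. 6.3.10 (p0318 L48 – p0319 L3)] -/
theorem graphClass_intMul_eq_sum (n : ℤ) :
    integralHodgeClassesPushforward 0 g₁ (graphHom (intMul X n)) eX e hX hg₁ hc hg' (unitIntegralHodgeClass X) =
      ∑ s ∈ Finset.range (2 * g₁ + 1), (n ^ s) • kunnethProjector X eX e hX hg₁ hc hg' (2 * g₁ - s) := by
  rw [← integralHodgeClassesPushforward_swapHom_swapHom X X e e hc hg'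
      (integralHodgeClassesPushforward 0 g₁ (graphHom (intMul X n)) eX e hX hg₁ hc hg' (unitIntegralHodgeClass X)),
    integralHodgeClassesPushforward_swapHom_graphClass_intMul_eq_sum, map_sum]
  exact Finset.sum_congr rfl fun s hs ↦ by
    rw [map_zsmul, integralHodgeClassesPushforward_swapHom_kunnethProjector X eX e hX hg₁ hc hg' s (2 * g₁ - s) (by have := Finset.mem_range.1 hs; omega)]

/-! ### §4 Uniqueness: the `π_s` are THE eigen-decomposition of `[Δ_X]` -/

/-- **UNIQUENESS OF THE KÜNNETH DECOMPOSITION ON `Hdgᵍ(X × X, ℤ)`**: if `[Δ_X] = Σ_{s=0}^{2g} β_s` with integral Hodge classes `β_s` such that `(1_X × j_X)^* β_s = jˢ ·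
β_s` for the `2g + 1` multipliers `j = 0, 1, …, 2g`, then `β_s = π_s` for every `s ≤ 2g` (the eigenspaces (6.15) for distinct `s` are independent — Vandermonde
at the nodes `0, …, 2g`, Layer A's `kunnethCoeff`; Voisin: the decomposition `Hᵏ(X × Y) = ⊕ H^{k−s}(X) ⊗ Hˢ(Y)` is direct). [cite: VoisinHodgeI2002, §11.3.3 Thm. 11.38]
[cite: Lange2023AbelianVarietiesComplex, §6.3.3 (6.15)–(6.16) (p0316 L44 – p0317 L10) and §6.3.4 (p0317 L30–L32)] -/
theorem kunnethProjector_unique (β : ℕ → integralHodgeClasses (prodObj X X).toIsog.Φ g₁)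
    (hβ : ∀ s ≤ 2 * g₁, ∀ j : ℕ, j ≤ 2 * g₁ → integralHodgeClassesPullbackHom (prodMap (𝟙 X) (intMul X j)) g₁ (β s) = ((j : ℤ) ^ s) • β s)
    (hsum : ∑ s ∈ Finset.range (2 * g₁ + 1), β s = integralHodgeClassesPushforward 0 g₁ (diagHom X) eX e hX hg₁ hc hg' (unitIntegralHodgeClass X))
    {s : ℕ} (hs : s ≤ 2 * g₁) : β s = kunnethProjector X eX e hX hg₁ hc hg' s := by
  have hform : ∀ s' ≤ 2 * g₁, ∀ j : ℕ, j ≤ 2 * g₁ →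
      ((β s' : integralHodgeClasses (prodObj X X).toIsog.Φ g₁) : (X.toIsog.E × X.toIsog.E) [⋀^Fin (2 * g₁)]→L[ℝ] ℂ).compContinuousLinearMap (scaleSnd (j : ℝ)) =
        (((j : ℕ) : ℂ) ^ s') • ((β s' : integralHodgeClasses (prodObj X X).toIsog.Φ g₁) : (X.toIsog.E × X.toIsog.E) [⋀^Fin (2 * g₁)]→L[ℝ] ℂ) := fun s' hs' j hj ↦ by
    have h := congrArg Subtype.val (hβ s' hs' j hj)
    rw [coe_integralHodgeClassesPullbackHom_prodMap_id_intMul_natCast, AddSubgroupClass.coe_zsmul, ← Int.cast_smul_eq_zsmul ℂ, Int.cast_pow, Int.cast_natCast] at h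
    exact h
  refine Subtype.ext ?_
  rw [coe_kunnethProjector, ← hsum, AddSubmonoidClass.coe_finsetSum, kunnethComponent_sum,
    Finset.sum_congr rfl fun s' hs' ↦ kunnethComponent_eq_ite_of_forall_nat₉ (Nat.le_of_lt_succ (Finset.mem_range.1 hs'))
      (hform s' (Nat.le_of_lt_succ (Finset.mem_range.1 hs'))) s,
    Finset.sum_ite_eq, if_pos (Finset.mem_range.2 (Nat.lt_succ_of_le hs))]

/-- Conversely the `π_s` are such a decomposition: `(1_X × j_X)^* π_s = jˢ π_s` at every node (§2) and `Σ π_s = [Δ]` (g29-#5). [cite: Lange2023AbelianVarietiesComplex, §6.3.4 (6.17) (p0318 L8–L9)] -/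
theorem integralHodgeClassesPullbackHom_prodMap_id_intMul_natCast_kunnethProjector (j s : ℕ) :
    integralHodgeClassesPullbackHom (prodMap (𝟙 X) (intMul X j)) g₁ (kunnethProjector X eX e hX hg₁ hc hg' s) = ((j : ℤ) ^ s) • kunnethProjector X eX e hX hg₁ hc hg' s :=
  integralHodgeClassesPullbackHom_prodMap_id_intMul_kunnethProjector X eX e hX hg₁ hc hg' j s

end Diagonal

end ComplexTorusCat

end Literature.AlgebraicGeometry.HodgeTheory
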